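import Literature.Topology.FourManifolds.DehnSurgeryTubularNbhdProofs
import HarnessLib

/-!
# Thin tubes and the radial line through a point of a knot

Topic `Literature/Topology/FourManifolds` (trunk T-4MAN); fact seat
`provefact-Literature.Topology.FourManifolds.Knot.exists_isBandSum` (`BandSum.lean`: existence of
band sums of two disjoint knots `K₁`, `K₂`, Gompf–Stipsicz (1999), §5.1).  The band is built along
an auxiliary embedded circle which crosses `K₁` and `K₂` once each; the two crossings are
prescribed **radial lines** of the tubular neighbourhoods of the knots (`K.tubularMap`,
`DehnSurgeryTubularNbhdProofs.lean`: Hirsch's tube `(θ, w) ↦ (γ θ + w₀ N₁ θ + w₁ N₂ θ)/‖⋯‖` over a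
positively oriented normal framing, squeezed to an injectivity radius — a smooth embedding
`𝕊¹ × ℝ² → 𝕊³` with `tubularMap (u, 0) = K u`).  This file records, for a knot `K : 𝕊¹ → 𝕊³`:

* `Literature.Topology.FourManifolds.SphereEmbedding.exists_forall_tubularMap_mem` — **thin tubes
  lie in any neighbourhood of the knot**: for `V` open containing `range K` there is `ρ > 0` with
  `tubularMap (u, w) ∈ V` whenever `‖w‖ < ρ` (tube lemma over the compact zero section);
* `Literature.Topology.FourManifolds.SphereEmbedding.tubularMap_mem_range_iff` — a tube point
  lies on the knot iff its fibre coordinate vanishes;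
* `Literature.Topology.FourManifolds.injective_mfderiv_of_deriv_coe_ne_zero` — a smooth curve
  `ℝ → 𝕊³` whose velocity read in `ℝ⁴` is nonzero has injective differential (chain rule with
  the inclusion `𝕊³ ⊆ ℝ⁴`);
* `Literature.Topology.FourManifolds.SphereEmbedding.exists_radial_line` — **the radial line**
  `t ↦ tubularMap (circlePoint θ, σ_ε (t e₀))` through `K (circlePoint θ)` (`σ_ε` the squeeze
  `w ↦ ε w / √(1 + ‖w‖²)` of the tree): a smooth injective immersion `ℝ → 𝕊³` inside the tube of
  radius `ε`, meeting the knot only at `t = 0`, and **transverse to the knot there**: the velocity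
  of the knot at `circlePoint θ` is not a multiple of the velocity of the line (the frame
  `(γ, γ', N₁, N₂)` is non-degenerate, `frameDet_curve_tangent_normal_ne_zero`).

Everything here is proved; no definitions, no named facts.

## References

* M. W. Hirsch, *Differential Topology*, GTM 33 (1976), Ch. 4 §5, Thms. 5.1–5.2 (tubular
  neighbourhoods). [Hirsch1976]
* R. E. Gompf, A. I. Stipsicz, *4-Manifolds and Kirby Calculus*, GSM 20, AMS (1999), §5.1
  (the consumer). [GompfStipsicz1999]
-/

open scoped Manifold ContDiff Topology RealInnerProductSpace
open Function Set Metric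

noncomputable section

namespace Literature.Topology.FourManifolds

/-- Local notation: `𝔼 n` is the model Euclidean space `EuclideanSpace ℝ (Fin n)`. -/
local notation "𝔼 " n:arg => EuclideanSpace ℝ (Fin n)

/-- Local notation: `𝕊 n` is the unit sphere in `EuclideanSpace ℝ (Fin (n + 1))`. -/
local notation "𝕊 " n:arg => (Metric.sphere (0 : EuclideanSpace ℝ (Fin (n + 1))) 1)

/-- Local notation: the model with corners of `𝕊¹ × ℝ²`. -/
local notation "𝓘₁₂" => (ModelWithCorners.prod (𝓡 1) 𝓘(ℝ, EuclideanSpace ℝ (Fin 2)))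

attribute [local instance] fact_finrank_euclideanSpace_two fact_finrank_euclideanSpace_four

/-! ### Curves into the sphere -/

/-- **Ambient versus intrinsic velocity**: a smooth curve `γ : ℝ → 𝕊³` whose velocity read in
`ℝ⁴` is nonzero at `t` has injective differential at `t` (chain rule with the inclusion
`𝕊³ ⊆ ℝ⁴`; the curve analogue of `injective_mfderiv_of_injective_fderiv_coe`,
`FlatteningChart.lean`). [folklore] -/
theorem injective_mfderiv_of_deriv_coe_ne_zero {γ : ℝ → 𝕊 3}
    (hγ : ContMDiff 𝓘(ℝ, ℝ) (𝓡 3) ∞ γ) {t : ℝ}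
    (h : deriv (fun s ↦ ((γ s : 𝕊 3) : 𝔼 4)) t ≠ 0) :
    Injective (mfderiv 𝓘(ℝ, ℝ) (𝓡 3) γ t) := by
  have hn : (∞ : WithTop ℕ∞) ≠ 0 := by simp
  have hcomp : fderiv ℝ (fun s ↦ ((γ s : 𝕊 3) : 𝔼 4)) t =
      (mfderiv (𝓡 3) 𝓘(ℝ, 𝔼 4) (Subtype.val : 𝕊 3 → 𝔼 4) (γ t)).comp
        (mfderiv 𝓘(ℝ, ℝ) (𝓡 3) γ t) := by
    rw [← mfderiv_eq_fderiv]
    exact mfderiv_comp t (contMDiff_coe_sphere.mdifferentiableAt hn) (hγ.mdifferentiableAt hn)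
  have hinj : Injective (fderiv ℝ (fun s ↦ ((γ s : 𝕊 3) : 𝔼 4)) t) := by
    intro a b hab
    have h1 : (a - b) • deriv (fun s ↦ ((γ s : 𝕊 3) : 𝔼 4)) t = 0 := by
      rw [← fderiv_apply_one_eq_deriv, ← map_smul, smul_eq_mul, mul_one, map_sub, hab, sub_self]
    rcases smul_eq_zero.1 h1 with h2 | h2
    · linarith
    · exact absurd h2 h
  have hfun : ⇑(fderiv ℝ (fun s ↦ ((γ s : 𝕊 3) : 𝔼 4)) t) =
      ⇑(mfderiv (𝓡 3) 𝓘(ℝ, 𝔼 4) (Subtype.val : 𝕊 3 → 𝔼 4) (γ t)) ∘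
        ⇑(mfderiv 𝓘(ℝ, ℝ) (𝓡 3) γ t) := by
    rw [hcomp]; rfl
  rw [hfun] at hinj
  exact hinj.of_comp

/-- If `det (r₀, r₁, r₂, r₃) ≠ 0` then `r₁` is not in the span of `r₀` and `r₂`. [folklore] -/
theorem frameDet_eq_zero_of_mem_span (r₀ r₂ r₃ : 𝔼 4) (a b : ℝ) :
    frameDet r₀ (a • r₀ + b • r₂) r₂ r₃ = 0 := by
  rw [frameDet_expand]
  simp only [PiLp.add_apply, PiLp.smul_apply, smul_eq_mul]
  ring

namespace SphereEmbedding

variable (K : SphereEmbedding 1 3)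

/-! ### Thin tubes -/

/-- **Thin tubes lie in any neighbourhood of the knot**: for an open `V ⊇ range K` there is
`ρ > 0` such that `tubularMap (u, w) ∈ V` for all `u` and all `‖w‖ < ρ` (the preimage of `V` is an
open neighbourhood of the compact zero section `𝕊¹ × {0}`; generalized tube lemma).
[folklore] -/
theorem exists_forall_tubularMap_mem {V : Set (𝕊 3)} (hV : IsOpen V) (hKV : range K ⊆ V) :
    ∃ ρ > 0, ∀ (u : 𝕊 1) (w : 𝔼 2), ‖w‖ < ρ → K.tubularMap (u, w) ∈ V := by
  set S : Set ((𝕊 1) × 𝔼 2) := K.tubularMap ⁻¹' V with hS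
  have hSo : IsOpen S := hV.preimage K.contMDiff_tubularMap.continuous
  have hsub : (univ : Set (𝕊 1)) ×ˢ ({0} : Set (𝔼 2)) ⊆ S := by
    rintro ⟨u, w⟩ ⟨-, hw⟩
    rw [mem_singleton_iff] at hw
    subst hw
    change K.tubularMap (u, 0) ∈ V
    rw [tubularMap_zero]
    exact hKV ⟨u, rfl⟩
  obtain ⟨U, W, -, hWo, hU, hW, hUW⟩ :=
    generalized_tube_lemma isCompact_univ isCompact_singleton hSo hsub
  obtain ⟨ρ, hρ, hball⟩ := Metric.isOpen_iff.1 hWo 0 (hW (mem_singleton 0))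
  refine ⟨ρ, hρ, fun u w hw ↦ ?_⟩
  have : (u, w) ∈ U ×ˢ W := ⟨hU (mem_univ u), hball (by simpa using hw)⟩
  exact hUW this

/-- **A tube point lies on the knot iff its fibre coordinate vanishes** (the tubular map is
injective and extends the knot). [folklore] -/
theorem tubularMap_mem_range_iff (u : 𝕊 1) (w : 𝔼 2) :
    K.tubularMap (u, w) ∈ range K ↔ w = 0 := by
  constructor
  · rintro ⟨u', hu'⟩
    rw [← tubularMap_zero] at hu'
    exact (congrArg Prod.snd (K.tubularMap_injective hu')).symm
  · rintro rfl
    exact ⟨u, (K.tubularMap_zero u).symm⟩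

/-! ### The radial line through a point of the knot -/

/-- The squeeze map restricted to the first axis: its differential at `t e₀` sends `e₀` to the
positive multiple `ε ρ³ e₀`, `ρ = (1 + t²)^{-1/2}`. [folklore] -/
theorem squeezeFDeriv_axis (ε t : ℝ) :
    squeezeFDeriv ε (t • EuclideanSpace.single 0 (1 : ℝ)) (EuclideanSpace.single 0 1) =
      (ε * squeezeFactor (t • EuclideanSpace.single 0 (1 : ℝ)) ^ 3) •
        EuclideanSpace.single 0 (1 : ℝ) := by
  set e₀ : 𝔼 2 := EuclideanSpace.single 0 1 with he₀
  set ρ := squeezeFactor (t • e₀) with hρ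
  have he₀n : ‖e₀‖ = 1 := by rw [he₀]; simp
  have hnorm : ‖t • e₀‖ ^ 2 = t ^ 2 := by
    rw [norm_smul, he₀n, mul_one, Real.norm_eq_abs, sq_abs]
  have hρ2 : ρ ^ 2 * (1 + t ^ 2) = 1 := by
    rw [← hnorm]
    exact squeezeFactor_sq_mul (t • e₀)
  rw [squeezeFDeriv_single]
  have h0 : (t • e₀) 0 = t := by simp [he₀]
  rw [h0, smul_smul, ← add_smul]
  congr 1
  rw [show ε * ρ + -(ε * ρ ^ 3 * t) * t = ε * ρ * (1 - ρ ^ 2 * t ^ 2) by ring]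
  have : 1 - ρ ^ 2 * t ^ 2 = ρ ^ 2 := by linarith
  rw [this]
  ring

/-- The squeeze map at the origin is `ε • id` to first order. [folklore] -/
theorem squeezeFDeriv_zero (ε : ℝ) (h : 𝔼 2) : squeezeFDeriv ε 0 h = ε • h := by
  rw [squeezeFDeriv_apply]
  simp

/-- **The radial line through a point of the knot.**  For a knot `K`, an angle `θ` and `ε > 0`
there is a smooth injective immersion `γ : ℝ → 𝕊³` (namely
`t ↦ tubularMap (circlePoint θ, σ_ε (t e₀))`, the squeezed first fibre axis of the tubular
neighbourhood) with `γ 0 = K (circlePoint θ)`, running inside the tube of radius `ε`, meeting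
the knot only at `t = 0`, and transverse to the knot at that point: the velocity of the knot is
not a multiple of the velocity of the line (the frame `(γ, γ', N₁, N₂)` of the tube is
non-degenerate). Hirsch (1976), Ch. 4 §5. [cite: Hirsch1976, §4.5 Thm 5.1] -/
theorem exists_radial_line (θ : ℝ) {ε : ℝ} (hε : 0 < ε) :
    ∃ γ : ℝ → 𝕊 3, ContMDiff 𝓘(ℝ, ℝ) (𝓡 3) ∞ γ ∧ Injective γ ∧
      (∀ t, Injective (mfderiv 𝓘(ℝ, ℝ) (𝓡 3) γ t)) ∧ γ 0 = K (circlePoint θ) ∧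
      (∀ t, ∃ w : 𝔼 2, ‖w‖ < ε ∧ γ t = K.tubularMap (circlePoint θ, w)) ∧
      (∀ t, t ≠ 0 → γ t ∉ range K) ∧
      ∀ c : ℝ, K.tangent θ ≠ c • deriv (fun t ↦ ((γ t : 𝕊 3) : 𝔼 4)) 0 := by
  set e₀ : 𝔼 2 := EuclideanSpace.single 0 1 with he₀
  have he₀ne : e₀ ≠ 0 := by
    intro h
    have := congrArg (fun v : 𝔼 2 ↦ v 0) h
    simp [he₀] at this
  set R := K.tubularRadius with hR
  set w : ℝ → 𝔼 2 := fun t ↦ squeeze ε (t • e₀) with hw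
  set γ : ℝ → 𝕊 3 := fun t ↦ K.tubularMap (circlePoint θ, w t) with hγ
  -- the line read in `ℝ⁴` is the squeezed tube along the first fibre axis
  have hcoe : ∀ t, ((γ t : 𝕊 3) : 𝔼 4) = K.tubeδ R (θ, w t) := fun t ↦
    K.coe_tubularMap_circlePoint θ (w t)
  -- smoothness
  have hws : ContDiff ℝ ∞ w := (contDiff_squeeze ε).comp (contDiff_id.smul contDiff_const)
  have hγs : ContMDiff 𝓘(ℝ, ℝ) (𝓡 3) ∞ γ := by
    have hin : ContMDiff 𝓘(ℝ, ℝ) 𝓘₁₂ ∞ fun t : ℝ ↦ ((circlePoint θ, w t) : (𝕊 1) × 𝔼 2) :=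
      contMDiff_const.prodMk hws.contMDiff
    exact K.contMDiff_tubularMap.comp hin
  -- velocity in `ℝ⁴`
  have hwd : ∀ t, HasDerivAt w (squeezeFDeriv ε (t • e₀) e₀) t := fun t ↦ by
    have h1 : HasDerivAt (fun s : ℝ ↦ s • e₀) e₀ t := by
      simpa using (hasDerivAt_id t).smul_const e₀
    exact (hasFDerivAt_squeeze ε (t • e₀)).comp_hasDerivAt t h1
  have hγd : ∀ t, HasDerivAt (fun s ↦ ((γ s : 𝕊 3) : 𝔼 4))
      (fderiv ℝ (K.tubeδ R) (θ, w t) ((0 : ℝ), squeezeFDeriv ε (t • e₀) e₀)) t := fun t ↦ by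
    have hpair : HasDerivAt (fun s : ℝ ↦ ((θ, w s) : ℝ × 𝔼 2))
        ((0 : ℝ), squeezeFDeriv ε (t • e₀) e₀) t := (hasDerivAt_const t θ).prodMk (hwd t)
    have h := ((K.differentiable_tubeδ R) (θ, w t)).hasFDerivAt.comp_hasDerivAt t hpair
    refine h.congr_of_eventuallyEq (Filter.Eventually.of_forall fun s ↦ ?_)
    exact hcoe s
  have hvne : ∀ t, squeezeFDeriv ε (t • e₀) e₀ ≠ 0 := fun t ↦ by
    rw [he₀, squeezeFDeriv_axis, ← he₀]
    exact smul_ne_zero (mul_pos hε (pow_pos (squeezeFactor_pos _) 3)).ne' he₀ne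
  have hderiv_ne : ∀ t, deriv (fun s ↦ ((γ s : 𝕊 3) : 𝔼 4)) t ≠ 0 := fun t ↦ by
    rw [(hγd t).deriv]
    intro h0
    have hinj := K.fderiv_tubeδ_injective K.tubularRadius_pos K.tubularRadius_le_jacobiRadius (θ, w t)
    have : ((0 : ℝ), squeezeFDeriv ε (t • e₀) e₀) = 0 := hinj (h0.trans (map_zero _).symm)
    exact hvne t (congrArg Prod.snd this)
  refine ⟨γ, hγs, ?_, fun t ↦ injective_mfderiv_of_deriv_coe_ne_zero hγs (hderiv_ne t), ?_,
    fun t ↦ ⟨w t, norm_squeeze_lt hε _, rfl⟩, fun t ht hmem ↦ ?_, fun c hc ↦ ?_⟩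
  · -- injective
    intro s t hst
    have h1 := K.tubularMap_injective hst
    have h2 : w s = w t := congrArg Prod.snd h1
    have h3 : s • e₀ = t • e₀ := squeeze_injective hε h2
    exact smul_left_injective ℝ he₀ne h3
  · -- through the point of the knot
    change K.tubularMap (circlePoint θ, squeeze ε ((0 : ℝ) • e₀)) = K (circlePoint θ)
    rw [zero_smul, squeeze_zero, tubularMap_zero]
  · -- off the knot for `t ≠ 0`
    rw [hγ] at hmem
    have h1 : w t = 0 := (K.tubularMap_mem_range_iff _ _).1 hmem
    have h2 : t • e₀ = 0 := squeeze_injective hε (by rw [squeeze_zero]; exact h1)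
    rcases smul_eq_zero.1 h2 with h | h
    · exact ht h
    · exact he₀ne h
  · -- transversality at `t = 0`
    have hw0 : w 0 = 0 := by simp [hw]
    have hv0 : squeezeFDeriv ε ((0 : ℝ) • e₀) e₀ = ε • e₀ := by
      rw [zero_smul, squeezeFDeriv_zero]
    have hder : deriv (fun s ↦ ((γ s : 𝕊 3) : 𝔼 4)) 0 =
        (R * ε) • fderiv ℝ K.tube (θ, 0) ((0 : ℝ), e₀) := by
      rw [(hγd 0).deriv, hv0, hw0, (K.hasFDerivAt_tubeδ R θ 0).fderiv]
      simp only [ContinuousLinearMap.comp_apply, ContinuousLinearMap.prod_apply,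
        ContinuousLinearMap.coe_fst', ContinuousLinearMap.coe_snd', squeeze_zero, map_smul,
        squeezeFDeriv_zero, smul_smul]
      rw [← map_smul]
      congr 1
      ext <;> simp [mul_comm]
    obtain ⟨c', hc'⟩ := K.fderiv_tube_zero_snd θ (i := 0) (K.tubeRaw_single_zero θ)
    rw [← he₀] at hc'
    rw [hder, hc', smul_smul, smul_add, smul_smul] at hc
    have hdet := K.frameDet_curve_tangent_normal_ne_zero θ
    rw [hc] at hdet
    exact hdet (frameDet_eq_zero_of_mem_span _ _ _ _ _)

end SphereEmbedding

end Literature.Topology.FourManifolds
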